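import Summits.AtomisticToContinuum.FouriersLaw.Theses.OddSectorIrreversibility
import Literature.MathematicalPhysics.KineticTheory.LangevinChainSDE

/-!
# Sketch — crux-ideate round 1, ideator 1, crux `ClosedConeSensitivity` (stmt-AtomisticToContinuum-14059)

First-lemma signatures for the two idea cards (they need not be proved here; they must elaborate):

* Card A `weighted-temperature-closure`: `TiltedDifferenceEnergyInequality` (deterministic, fixed `N`, the
  first checkable statement of the line) and `ClosureGivesCone` (the bookkeeping that turns the closure
  hypothesis `WeightedTemperatureBound` into the crux shape, for the local difference energy).
* Card B `quartic-blowup-rigidity`: `quarticScaling` (the exact top-order homogeneity of the pinned-chain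
  Hamiltonian, stated; provable by `ring`-level algebra) and `ColdConeUnderCap` (the unconditional "cold"
  piece: the crux inequality on the event that local energies stay below a cap `K` on `[0,t]`).

Closed flow: `(pinnedChain ω₂ lam β 0).chainFlow N x 0 t` (zero friction, zero noise path) — by the refuter's
W.lean, `(pinnedChain ω₂ lam β 0).transitionKernel N T T t x = Measure.dirac (chainFlow … x 0 t)`, so statements over
`chainFlow` are statements about the crux's kernels.
-/

noncomputable section

open MeasureTheory Set Filter Finset
open scoped BigOperators

namespace Summit.AtomisticToContinuum.FouriersLaw.Cruxes.ClosedConeSensitivity.Ideator1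

open Literature.MathematicalPhysics.KineticTheory.HeatConduction

/-! ## Shared vocabulary (explicit helper definitions of this sketch) -/

/-- Site-centred local energy of the pinned chain at site `k`: `p_k²/2 + U(q_k)` plus HALF of each adjacent
bond energy `V(q_{k+1}-q_k)`, `V(q_k-q_{k-1})` (free ends). -/
def siteEnergyN (ω₂ lam β : ℝ) {N : ℕ} (x : PhaseSpace N) (k : Fin N) : ℝ :=
  x.2 k ^ 2 / 2 + (ω₂ * x.1 k ^ 2 / 2 + lam * x.1 k ^ 4 / 4) +
    ∑ j : Fin N, (if j.val = k.val + 1 ∨ k.val = j.val + 1 then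
      ((x.1 j - x.1 k) ^ 2 / 2 + β * (x.1 j - x.1 k) ^ 4 / 4) / 2 else 0)

/-- Averaged on-site stiffness between two positions: `∫₀¹ U''(q + θ(q'-q)) dθ ≥ ω₂` (mean-value form of
`U'(q') - U'(q) = ā·(q'-q)`). -/
def avgUpp (ω₂ lam : ℝ) (q q' : ℝ) : ℝ :=
  ∫ θ in (0:ℝ)..1, (ω₂ + 3 * lam * (q + θ * (q' - q)) ^ 2)

/-- Averaged bond stiffness between two stretches: `∫₀¹ V''(r + θ(r'-r)) dθ ≥ 1`. -/
def avgVpp (β : ℝ) (r r' : ℝ) : ℝ :=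
  ∫ θ in (0:ℝ)..1, (1 + 3 * β * (r + θ * (r' - r)) ^ 2)

/-- Site-centred local DIFFERENCE energy of two phase points at site `k` (the perturbation energy density of
card A): `Δp_k²/2 + ā_k Δq_k²/2 + ¼ Σ_{adjacent bonds} b̄ (Δr)²`, with the averaged stiffnesses `ā ≥ ω₂`,
`b̄ ≥ 1` — a time-dependent POSITIVE quadratic form because `U`, `V` are convex. -/
def diffEnergy (ω₂ lam β : ℝ) {N : ℕ} (x x' : PhaseSpace N) (k : Fin N) : ℝ :=
  (x'.2 k - x.2 k) ^ 2 / 2 + avgUpp ω₂ lam (x.1 k) (x'.1 k) * (x'.1 k - x.1 k) ^ 2 / 2 +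
    ∑ j : Fin N, (if j.val = k.val + 1 ∨ k.val = j.val + 1 then
      avgVpp β (x.1 j - x.1 k) (x'.1 j - x'.1 k) * ((x'.1 j - x'.1 k) - (x.1 j - x.1 k)) ^ 2 / 4 else 0)

/-- The LOCAL RATE of card A at site `k` for tilt `θ`: `C₀ ×` (momenta within distance one of `k`, both
configurations) — the parametric PUMPING rate, from `(U''')² ≤ 12·lam·U''`, `(V''')² ≤ 12·β·V''` — plus
`(e^θ - 1)·C₁ ×` (one plus the stretches of the bonds at `k`, both configurations) — the TRANSPORT rate, i.e.
the local sound speed `√(b̄) ≤ 1 + √(3β)(|r|+|r'|)` paid once per unit of tilt. -/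
def localRate (C₀ C₁ θ : ℝ) {N : ℕ} (x x' : PhaseSpace N) (k : Fin N) : ℝ :=
  C₀ * ∑ j : Fin N, (if j.val + 1 = k.val ∨ j = k ∨ j.val = k.val + 1 then (|x.2 j| + |x'.2 j|) else 0) +
    (Real.exp θ - 1) * C₁ *
      (2 + ∑ j : Fin N, (if j.val = k.val + 1 ∨ k.val = j.val + 1 then (|x.1 j - x.1 k| + |x'.1 j - x'.1 k|) else 0))

/-! ## Card A — first lemma (deterministic) and the closure bookkeeping -/

/-- **First lemma of card A (TiltedDifferenceEnergyInequality; deterministic, fixed `N`, size M).** For the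
CLOSED pinned chain (`γ = 0`, zero noise path) and ANY two initial data `x, x'`, the exponentially tilted
perturbation energy `W_θ(t) = Σ_k e^{θk} ε_k(t)`, `ε_k(t) = diffEnergy(Φ_t x, Φ_t x')(k)`, obeys the integrated
differential inequality `W_θ(t₂) ≤ W_θ(t₁) + ∫_{t₁}^{t₂} Σ_k e^{θk} Λ_k(t) ε_k(t) dt` with the LOCAL rate
`Λ_k = localRate C₀ C₁ θ (Φ_t x) (Φ_t x') k`. Content: local energy balance of the linear "difference chain"
(its current is `φ_k = -½ b̄_k Δr_k (Δp_k + Δp_{k+1})`, `|φ_k| ≤ 3√(b̄_k)(ε_k + ε_{k+1})`), the pumping bound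
`½|ā̇_k| Δq_k² ≤ 2√(3lam/ω₂)(|p_k|+|p'_k|)·(½ ā_k Δq_k²)` from convexity, and the tilt `Σ_k e^{θk}(φ_{k-1} - φ_k) =
(e^θ-1)Σ_k e^{θk} φ_k`. The tilt is towards the RIGHT of the kick (contact `b = 0`); the mirror statement serves
`b = N-1`. -/
def TiltedDifferenceEnergyInequality : Prop :=
  ∀ ω₂ lam β : ℝ, 0 < ω₂ → 0 < lam → 0 < β → ∃ C₀ C₁ : ℝ, 0 ≤ C₀ ∧ 0 ≤ C₁ ∧
    ∀ (θ : ℝ), 0 ≤ θ → ∀ (N : ℕ) (x x' : PhaseSpace N) (t₁ t₂ : ℝ), 0 ≤ t₁ → t₁ ≤ t₂ →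
      let P₀ := pinnedChain ω₂ lam β 0
      let Φ : PhaseSpace N → ℝ → PhaseSpace N := fun y t => P₀.chainFlow N y 0 t
      let W : ℝ → ℝ := fun t => ∑ k : Fin N, Real.exp (θ * k.val) * diffEnergy ω₂ lam β (Φ x t) (Φ x' t) k
      W t₂ ≤ W t₁ + ∫ t in t₁..t₂, ∑ k : Fin N,
        Real.exp (θ * k.val) * (localRate C₀ C₁ θ (Φ x t) (Φ x' t) k * diffEnergy ω₂ lam β (Φ x t) (Φ x' t) k)

/-- **The closure hypothesis of card A (WeightedTemperatureBound) — the residual, rank-2 content of the line.**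
Under the Gibbs weight `μ_T` on the initial datum (the kicked replica `x' = x + s·e_{p_b}` riding along), the local
rate is bounded IN THE PERTURBATION-ENERGY-WEIGHTED ENSEMBLE: `∫ Λ_k(t) ε_k(t) dμ_T ≤ Λ* ∫ ε_k(t) dμ_T` for all
`N, k, t ≥ 0, s ∈ (0,1]`, `θ ≤ 1` ("the perturbation does not preferentially live where the chain is hot / stiff").
By invariance of `μ_T` under `Φ_t` the UNWEIGHTED law of `Λ_k(t)` is a fixed Gibbs law with Gaussian momenta, so this
is a statement about the tilt only. -/
def WeightedTemperatureBound : Prop :=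
  ∀ ω₂ lam β : ℝ, 0 < ω₂ → 0 < lam → 0 < β → ∀ T : ℝ, 0 < T → ∀ C₀ C₁ : ℝ, 0 ≤ C₀ → 0 ≤ C₁ →
    ∃ Λ : ℝ, ∀ (θ : ℝ), 0 ≤ θ → θ ≤ 1 → ∀ (N : ℕ) (k b : Fin N) (t s : ℝ), (b.val = 0 ∨ b.val = N - 1) →
      0 ≤ t → 0 < s → s ≤ 1 →
      let P := pinnedChain ω₂ lam β 1
      let P₀ := pinnedChain ω₂ lam β 0
      let Φ : PhaseSpace N → ℝ → PhaseSpace N := fun y t => P₀.chainFlow N y 0 t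
      let kick : PhaseSpace N → PhaseSpace N := fun y => (y.1, Function.update y.2 b (y.2 b + s))
      let μT : Measure (PhaseSpace N) :=
        volume.withDensity (fun y => ENNReal.ofReal (Real.exp (-(P.hamiltonian N y) / T)))
      ∫ y, localRate C₀ C₁ θ (Φ y t) (Φ (kick y) t) k * diffEnergy ω₂ lam β (Φ y t) (Φ (kick y) t) k ∂μT ≤
        Λ * ∫ y, diffEnergy ω₂ lam β (Φ y t) (Φ (kick y) t) k ∂μT

/-- **Closure bookkeeping of card A (ClosureGivesCone, size M given the two statements above + Fubini).**
The tilted inequality integrated against `μ_T`, the closure hypothesis and Grönwall give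
`∫ ε_i(t) dμ_T ≤ (s²/2) e^{-θ d + Λ t} · Z`, i.e. the crux shape `C s² e^{-κ(d - t/a)}` with `κ = θ`, `a = θ/Λ`,
FOR THE LOCAL DIFFERENCE ENERGY at the target site (tilt towards the target from the kicked contact; `W_θ(0) =
s²/2` exactly). Passing from `ε_i, ε_{i+1}` to the bond-current difference `(Δ j_i)² ≤ poly(x_t, x'_t)·(ε_i+ε_{i+1})`
is one more weighted-moment bound of the same family (recorded in the card, not typed here). -/
def ClosureGivesCone : Prop :=
  TiltedDifferenceEnergyInequality → WeightedTemperatureBound →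
  ∀ ω₂ lam β : ℝ, 0 < ω₂ → 0 < lam → 0 < β → ∀ T : ℝ, 0 < T → ∃ a κ C : ℝ, 0 < a ∧ 0 < κ ∧
    ∀ (N : ℕ) (i b : Fin N) (t s : ℝ), (b.val = 0 ∨ b.val = N - 1) → 0 ≤ t → 0 < s → s ≤ 1 →
      let P := pinnedChain ω₂ lam β 1
      let P₀ := pinnedChain ω₂ lam β 0
      let Φ : PhaseSpace N → ℝ → PhaseSpace N := fun y t => P₀.chainFlow N y 0 t
      let kick : PhaseSpace N → PhaseSpace N := fun y => (y.1, Function.update y.2 b (y.2 b + s))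
      let μT : Measure (PhaseSpace N) :=
        volume.withDensity (fun y => ENNReal.ofReal (Real.exp (-(P.hamiltonian N y) / T)))
      let d : ℕ := (if b.val = 0 then i.val else N - 1 - i.val)
      t ≤ a * (d : ℝ) →
        ∫ y, diffEnergy ω₂ lam β (Φ y t) (Φ (kick y) t) i ∂μT ≤
          C * s ^ 2 * Real.exp (-(κ * ((d : ℝ) - t / a))) * ∫ y, Real.exp (-(P.hamiltonian N y) / T) ∂volume

/-! ## Card B — the blow-up lattice and the cold piece -/

/-- **Exact top-order homogeneity (quarticScaling; provable by algebra).** Under the scaling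
`(q, p) ↦ (K^{1/4} q, K^{1/2} p)` the pinned-chain Hamiltonian splits as `K · H∞ + K^{1/2} · H₂` with
`H∞ = Σ p²/2 + lam q⁴/4 + Σ_bonds β r⁴/4` (the scale-free HOMOGENEOUS QUARTIC LATTICE) and `H₂` the harmonic
part; hence a hot spot of energy `K` per site evolves, on its own clock `t = K^{-1/4} τ`, by `H∞` up to
`O(K^{-1/2})`. Written with `Real.sqrt` (`K^{1/4} = √√K`). -/
def quarticScaling : Prop :=
  ∀ (ω₂ lam β γ K : ℝ), 0 ≤ K → ∀ (N : ℕ) (q p : Fin N → ℝ),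
    (pinnedChain ω₂ lam β γ).hamiltonian N
        (fun i => Real.sqrt (Real.sqrt K) * q i, fun i => Real.sqrt K * p i) =
      K * ((∑ i, (p i ^ 2 / 2 + lam * q i ^ 4 / 4)) +
            ∑ i : Fin N, ∑ j : Fin N, (if j.val = i.val + 1 then β * (q j - q i) ^ 4 / 4 else 0)) +
      Real.sqrt K * ((∑ i, ω₂ * q i ^ 2 / 2) +
            ∑ i : Fin N, ∑ j : Fin N, (if j.val = i.val + 1 then (q j - q i) ^ 2 / 2 else 0))

/-- **First lemma of card B (ColdConeUnderCap; the unconditional cold piece, size L).** On the event that ALL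
local energies of the unperturbed closed trajectory stay `≤ K` on `[0, t]`, the crux inequality holds with
constants depending on `K` (bounded stiffness ⇒ BM/Dobrushin–Fritz lattice iteration, the tree's
`BMLightCone.lattice_iteration_far`, then integrate; the kicked replica stays `K+1`-capped near the path by the
crude pass of the same iteration). Everything hot is pushed into the complement event, which card B handles by
blow-up to `H∞` and rigidity — NOT by its probability. -/
def ColdConeUnderCap : Prop :=
  ∀ ω₂ lam β : ℝ, 0 < ω₂ → 0 < lam → 0 < β → ∀ T K : ℝ, 0 < T → 0 < K → ∃ a κ C : ℝ, 0 < a ∧ 0 < κ ∧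
    ∀ (N : ℕ) (i b : Fin N) (t s : ℝ), (b.val = 0 ∨ b.val = N - 1) → 0 ≤ t → 0 < s → s ≤ 1 →
      let P := pinnedChain ω₂ lam β 1
      let P₀ := pinnedChain ω₂ lam β 0
      let Φ : PhaseSpace N → ℝ → PhaseSpace N := fun y t => P₀.chainFlow N y 0 t
      let kick : PhaseSpace N → PhaseSpace N := fun y => (y.1, Function.update y.2 b (y.2 b + s))
      let μT : Measure (PhaseSpace N) :=
        volume.withDensity (fun y => ENNReal.ofReal (Real.exp (-(P.hamiltonian N y) / T)))
      let G : Set (PhaseSpace N) := {y | ∀ τ ∈ Set.Icc (0:ℝ) t, ∀ k : Fin N, siteEnergyN ω₂ lam β (Φ y τ) k ≤ K}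
      let d : ℕ := (if b.val = 0 then i.val else N - 2 - i.val)
      t ≤ a * (d : ℝ) →
        ∫ y, G.indicator (fun y => (P.bondCurrent N i (Φ (kick y) t) - P.bondCurrent N i (Φ y t)) ^ 2) y ∂μT ≤
          C * s ^ 2 * Real.exp (-(κ * ((d : ℝ) - t / a))) * ∫ y, Real.exp (-(P.hamiltonian N y) / T) ∂volume

/-- Sanity: the four statements are well-formed propositions; the line of card A is the implication below
(its proof is the content of `ClosureGivesCone` plus the current-from-energy weighted moment). -/
example : Prop := TiltedDifferenceEnergyInequality ∧ WeightedTemperatureBound ∧ ClosureGivesCone ∧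
  quarticScaling ∧ ColdConeUnderCap

end Summit.AtomisticToContinuum.FouriersLaw.Cruxes.ClosedConeSensitivity.Ideator1

end
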